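import Mathlib
import Summits.Ventures.HodgeRepro2.T5RecordSatakeDiscriminant
import Summits.Ventures.HodgeRepro2.T5CyclotomicSevenInertThree
import Summits.Ventures.HodgeRepro2.T5RecordSatakeInertToy
import Summits.Ventures.HodgeRepro2.T5CyclotomicNineSextic

/-!
# THE DISCRIMINANT FORM ON THE CYCLOTOMIC FIELDS OF RECORD: `ℚ(ζ_ℓ)` OUTSIDE `ℓ`, `ℚ(ζ₇)` (`disc = −7⁵`), `ℚ(i)`
# (`disc = −4`), `ℚ(ζ₉)` (`disc = −3⁹`)

Tier-5 support N3 / §G-N4.2 (seat p3, gen 83). File 322's consumer statement needs ONE integer, the absolute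
discriminant: at every place of `K⁺` above a rational prime `p ∤ disc K` the record's local data are in kernel. On
the cyclotomic fields the discriminant is a numeral (Mathlib's `IsCyclotomicExtension.Rat.discr_prime` /
`discr_prime_pow_succ`), so the hypothesis set of file 322 is inhabited at every prime but one — README §10.5
(ii)(c)/(d) non-vacuity:

* **`not_dvd_discr_of_ne`** — for `ℓ` prime and `p ≠ ℓ`, `p ∤ disc ℚ(ζ_ℓ) = (−1)^{(ℓ−1)/2} ℓ^{ℓ−2}`;
  **`record_hecke_cyclotomic_prime_outside`** — for `ℓ > 2`, at every place of `ℚ(ζ_ℓ)⁺` above every prime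
  `p ≠ ℓ`: `e(v/p) = 1`, every `w ∣ v` prime to both differents with `e(w/p) = 1`, `H(U(1 ⊗ H), K_v)`
  commutative, `k[X]` + the Satake chain with numerals `q = p^{f(v/p)}` when one prime lies above `v` (files
  253–258 and 264–277 found the census of `ℚ(ζ₇)` / `ℚ(ζ_ℓ)` prime by prime; here the exceptional set is read
  off one integer);
* **`discr_seven`** — `disc ℚ(ζ₇) = −16807`; **`record_hecke_seven_outside_seven`** — the field of record at every
  `p ≠ 7`;
* **`discr_four`** — `disc ℚ(i) = −4`; **`record_hecke_four_outside_two`** — the toy field at every odd prime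
  (file 270's census re-derived from one integer);
* **`discr_nine`** — `disc ℚ(ζ₉) = −19683`; **`record_hecke_nine_outside_three`** — the second sextic instance at
  every `p ≠ 3`.

§8(d): uses an L-value-free non-vanishing device: NO.
-/

open Matrix NumberField NumberField.IsCMField IsDedekindDomain IsDedekindDomain.HeightOneSpectrum Module Polynomial
  Ideal
open scoped TensorProduct Pointwise
open Summit.Ventures.HodgeRepro2.T5UnitaryGroupForm Summit.Ventures.HodgeRepro2.T5UnitaryHeckeAdjoint
  Summit.Ventures.HodgeRepro2.T5HeckePermutationModule Summit.Ventures.HodgeRepro2.T5HeckeDoubleCoset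
  Summit.Ventures.HodgeRepro2.T5RecordHyperspecial Summit.Ventures.HodgeRepro2.T5GlobalLatticeAlmostAll
  Summit.Ventures.HodgeRepro2.T5FinitePlaceSplitClassification Summit.Ventures.HodgeRepro2.T5RecordSatakeIntrinsic
  Summit.Ventures.HodgeRepro2.T5SplitPlaceUnitaryGroup Summit.Ventures.HodgeRepro2.T5NonSplitPlaceUnitaryGroup
  Summit.Ventures.HodgeRepro2.T5FinitePlaceCM Summit.Ventures.HodgeRepro2.T5StarOfInvolution
  Summit.Ventures.HodgeRepro2.T5CyclotomicSubfieldHeckeCommutative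
  Summit.Ventures.HodgeRepro2.T5IntegralGramBadSet Summit.Ventures.HodgeRepro2.T5RecordSatakeDifferent
  Summit.Ventures.HodgeRepro2.T5CyclotomicTwentyOneSatake Summit.Ventures.HodgeRepro2.T5CyclotomicSevenHeckeCommutative
  Summit.Ventures.HodgeRepro2.T5RecordDifferentTower Summit.Ventures.HodgeRepro2.T5RecordUnramifiedEveryCMField
  Summit.Ventures.HodgeRepro2.T5RecordSatakeDiscriminant Summit.Ventures.HodgeRepro2.T5CMCensusToy

namespace Summit.Ventures.HodgeRepro2.T5RecordSatakeCyclotomicDiscriminant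

/-- The conclusions of file 322 at a place `v` of `K⁺` above `p`, packaged as a `Prop` over a variable CM field
(the device of file 291: statements on cyclotomic fields are made through `haveI` instances). -/
def Conclusions (K : Type*) [Field K] [NumberField K] [IsCMField K] {r : ℕ} (l : Fin r → 𝓞 K) (k : Type*)
    [Field k] [CharZero k] (M : Matrix (Fin 3) (Fin 3) (𝓞 K)) (p : ℕ)
    (v : HeightOneSpectrum (𝓞 (maximalRealSubfield K))) : Prop :=
  v.asIdeal.ramificationIdx ℤ = 1 ∧
  (∀ w : HeightOneSpectrum (𝓞 K), w.asIdeal.LiesOver v.asIdeal →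
    ¬ w.asIdeal ∣ differentIdeal (𝓞 (maximalRealSubfield K)) (𝓞 K) ∧
    ¬ w.asIdeal ∣ differentIdeal ℤ (𝓞 K) ∧ w.asIdeal.ramificationIdx ℤ = 1) ∧
  RecordCommutative K v l k ((algebraMap (𝓞 K) K).mapMatrix M) ∧
  ((v.asIdeal.primesOver (𝓞 K)).ncard = 1 →
    RecordPolynomial K v l k ((algebraMap (𝓞 K) K).mapMatrix M) ∧
    ∀ [Fact p.Prime],
      ChainNumerals K v l k ((algebraMap (𝓞 K) K).mapMatrix M) (p ^ v.asIdeal.inertiaDeg ℤ)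
        ((p ^ v.asIdeal.inertiaDeg ℤ) ^ 3 + 1) ((p ^ v.asIdeal.inertiaDeg ℤ) ^ 4)
        ((p ^ v.asIdeal.inertiaDeg ℤ) ^ 4 + p ^ v.asIdeal.inertiaDeg ℤ))

section General

variable (K : Type*) [Field K] [NumberField K] [IsCMField K]
variable {r : ℕ} (l : Fin r → 𝓞 K) (k : Type*) [Field k] [CharZero k]
  (hl : Submodule.span (𝓞 (maximalRealSubfield K)) (Set.range l) = ⊤)
variable (M : Matrix (Fin 3) (Fin 3) (𝓞 K)) (hM : IsUnit M.det)
  (hH : ((algebraMap (𝓞 K) K).mapMatrix M).IsHermitian)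

include hl hM hH in
/-- File 322's `record_hecke_outside_discriminant_prime` in the packaged form. -/
theorem conclusions_of_not_dvd_discr (p : ℕ) (hp : ¬ (p : ℤ) ∣ discr K)
    (v : HeightOneSpectrum (𝓞 (maximalRealSubfield K))) [v.asIdeal.LiesOver (span {(p : ℤ)})] :
    Conclusions K l k M p v := by
  unfold Conclusions
  exact record_hecke_outside_discriminant_prime K l k hl M hM hH p hp v

end General

section PrimeCyclotomic

variable (ell : ℕ) [hell : Fact ell.Prime]
variable (K : Type*) [Field K] [CharZero K] [IsCyclotomicExtension {ell} ℚ K]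

include ell in
omit hell in
/-- `ℚ(ζ_ℓ)` is a number field. -/
theorem numberField_prime : NumberField K := IsCyclotomicExtension.numberField {ell} ℚ K

include ell in
omit hell in
/-- `ℚ(ζ_ℓ)` is a CM field for `ℓ > 2` (Mathlib's `IsCyclotomicExtension.Rat.isCMField`). -/
theorem isCMField_prime (hell2 : 2 < ell) : IsCMField K :=
  IsCyclotomicExtension.Rat.isCMField K (S := {ell}) ⟨ell, rfl, hell2⟩

/-- **`p ∤ disc ℚ(ζ_ℓ)` for every prime `p ≠ ℓ`** (Mathlib's `discr_prime`: `disc = (−1)^{(ℓ−1)/2} ℓ^{ℓ−2}`). -/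
theorem not_dvd_discr_of_ne (p : ℕ) [hp : Fact p.Prime] (hpell : p ≠ ell) :
    haveI := numberField_prime ell K
    ¬ (p : ℤ) ∣ discr K := by
  haveI := numberField_prime ell K
  rw [IsCyclotomicExtension.Rat.discr_prime (p := ell) (K := K)]
  intro h
  have hpZ : Prime (p : ℤ) := Nat.prime_iff_prime_int.mp hp.out
  have h1 : (p : ℤ) ∣ (ell : ℤ) ^ (ell - 2) := by
    rcases hpZ.dvd_mul.mp h with h | h
    · exfalso
      rcases neg_one_pow_eq_or ℤ ((ell - 1) / 2) with h' | h'
      · rw [h'] at h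
        exact hp.out.one_lt.ne' (by exact_mod_cast Int.eq_one_of_dvd_one (by positivity) h)
      · rw [h', dvd_neg] at h
        exact hp.out.one_lt.ne' (by exact_mod_cast Int.eq_one_of_dvd_one (by positivity) h)
    · exact h
  have h2 : p ∣ ell ^ (ell - 2) := by exact_mod_cast h1
  exact hpell ((Nat.prime_dvd_prime_iff_eq hp.out hell.out).mp (hp.out.dvd_of_dvd_pow h2))

variable (hell2 : 2 < ell)
variable {r : ℕ} (l : Fin r → 𝓞 K) (k : Type*) [Field k] [CharZero k]
variable (M : Matrix (Fin 3) (Fin 3) (𝓞 K)) (hM : IsUnit M.det)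
  (hH : haveI := numberField_prime ell K; haveI := isCMField_prime ell K hell2;
    ((algebraMap (𝓞 K) K).mapMatrix M).IsHermitian)

include hell2 hM hH in
/-- **THE RECORD'S LOCAL DATA ON `ℚ(ζ_ℓ)` (`ℓ > 2`) AT EVERY PLACE ABOVE EVERY PRIME `p ≠ ℓ`** — `e(v/p) = 1`, every
`w ∣ v` prime to both differents with `e(w/p) = 1`, `H(U(1 ⊗ H), K_v)` commutative, `k[X]` + the Satake chain with
numerals `q = p^{f(v/p)}` when one prime lies above `v` (file 322 with `p ∤ disc`). -/
theorem record_hecke_cyclotomic_prime_outside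
    (hl : haveI := numberField_prime ell K; Submodule.span (𝓞 (maximalRealSubfield K)) (Set.range l) = ⊤)
    (p : ℕ) [Fact p.Prime] (hpell : p ≠ ell)
    (v : haveI := numberField_prime ell K; HeightOneSpectrum (𝓞 (maximalRealSubfield K)))
    [hvp : v.asIdeal.LiesOver (span {(p : ℤ)})] :
    haveI := numberField_prime ell K
    haveI := isCMField_prime ell K hell2
    Conclusions K l k M p v :=
  haveI := numberField_prime ell K
  haveI := isCMField_prime ell K hell2
  conclusions_of_not_dvd_discr K l k hl M hM hH p (not_dvd_discr_of_ne ell K p hpell) v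

end PrimeCyclotomic

section Seven

variable (K : Type*) [Field K] [CharZero K] [IsCyclotomicExtension {7} ℚ K]

/-- **`disc ℚ(ζ₇) = −16807 = −7⁵`** (Mathlib's `discr_prime`). -/
theorem discr_seven :
    haveI := T5CyclotomicSevenInertThree.numberField' K
    discr K = -16807 := by
  haveI := T5CyclotomicSevenInertThree.numberField' K
  haveI : Fact (Nat.Prime 7) := ⟨by norm_num⟩
  rw [IsCyclotomicExtension.Rat.discr_prime (p := 7) (K := K)]
  norm_num

variable {r : ℕ} (l : Fin r → 𝓞 K) (k : Type*) [Field k] [CharZero k]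
variable (M : Matrix (Fin 3) (Fin 3) (𝓞 K)) (hM : IsUnit M.det)
  (hH : haveI := T5CyclotomicSevenInertThree.numberField' K; haveI := T5CyclotomicSevenInertThree.isCMField' K;
    ((algebraMap (𝓞 K) K).mapMatrix M).IsHermitian)

include hM hH in
/-- **THE FIELD OF RECORD `ℚ(ζ₇)` AT EVERY PLACE ABOVE EVERY PRIME `p ≠ 7`.** -/
theorem record_hecke_seven_outside_seven
    (hl : haveI := T5CyclotomicSevenInertThree.numberField' K;
      Submodule.span (𝓞 (maximalRealSubfield K)) (Set.range l) = ⊤)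
    (p : ℕ) [Fact p.Prime] (hp7 : p ≠ 7)
    (v : haveI := T5CyclotomicSevenInertThree.numberField' K; HeightOneSpectrum (𝓞 (maximalRealSubfield K)))
    [hvp : v.asIdeal.LiesOver (span {(p : ℤ)})] :
    haveI := T5CyclotomicSevenInertThree.numberField' K
    haveI := T5CyclotomicSevenInertThree.isCMField' K
    Conclusions K l k M p v :=
  haveI := T5CyclotomicSevenInertThree.numberField' K
  haveI := T5CyclotomicSevenInertThree.isCMField' K
  haveI : Fact (Nat.Prime 7) := ⟨by norm_num⟩
  conclusions_of_not_dvd_discr K l k hl M hM hH p (not_dvd_discr_of_ne 7 K p hp7) v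

end Seven

section Four

variable (L : Type*) [Field L] [CharZero L] [IsCyclotomicExtension {2 ^ 2} ℚ L]

/-- **`disc ℚ(i) = −4`** (Mathlib's `discr_prime_pow_succ` with `p = 2`, `k = 1`). -/
theorem discr_four :
    haveI := T5RecordSatakeInertToy.numberField L
    discr L = -4 := by
  haveI := T5RecordSatakeInertToy.numberField L
  rw [IsCyclotomicExtension.Rat.discr_prime_pow_succ (p := 2) (k := 1) (K := L)]
  norm_num

/-- **`p ∤ disc ℚ(i) = −4` for every odd prime `p`.** -/
theorem not_dvd_discr_four (p : ℕ) [hp : Fact p.Prime] (hp2 : p ≠ 2) :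
    haveI := T5RecordSatakeInertToy.numberField L
    ¬ (p : ℤ) ∣ discr L := by
  haveI := T5RecordSatakeInertToy.numberField L
  rw [discr_four L, dvd_neg]
  intro h
  have h2 : p ∣ 2 ^ 2 := by exact_mod_cast h
  exact hp2 ((Nat.prime_dvd_prime_iff_eq hp.out Nat.prime_two).mp (hp.out.dvd_of_dvd_pow h2))

variable {r : ℕ} (l : Fin r → 𝓞 L) (k : Type*) [Field k] [CharZero k]
variable (M : Matrix (Fin 3) (Fin 3) (𝓞 L)) (hM : IsUnit M.det)
  (hH : haveI := T5RecordSatakeInertToy.numberField L; haveI := isCMField_four L;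
    ((algebraMap (𝓞 L) L).mapMatrix M).IsHermitian)

include hM hH in
/-- **THE TOY FIELD `ℚ(i)` AT EVERY PLACE ABOVE EVERY ODD PRIME** (file 270's census from one integer). -/
theorem record_hecke_four_outside_two
    (hl : haveI := T5RecordSatakeInertToy.numberField L;
      Submodule.span (𝓞 (maximalRealSubfield L)) (Set.range l) = ⊤)
    (p : ℕ) [Fact p.Prime] (hp2 : p ≠ 2)
    (v : haveI := T5RecordSatakeInertToy.numberField L; HeightOneSpectrum (𝓞 (maximalRealSubfield L)))
    [hvp : v.asIdeal.LiesOver (span {(p : ℤ)})] :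
    haveI := T5RecordSatakeInertToy.numberField L
    haveI := isCMField_four L
    Conclusions L l k M p v :=
  haveI := T5RecordSatakeInertToy.numberField L
  haveI := isCMField_four L
  conclusions_of_not_dvd_discr L l k hl M hM hH p (not_dvd_discr_four L p hp2) v

end Four

section Nine

variable (K : Type*) [Field K] [CharZero K] [IsCyclotomicExtension {9} ℚ K]

/-- **`disc ℚ(ζ₉) = −19683 = −3⁹`** (Mathlib's `discr_prime_pow_succ` with `p = 3`, `k = 1`; `9 = 3 ^ (1 + 1)`). -/
theorem discr_nine :
    haveI := T5CyclotomicNineSextic.numberField_nine K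
    discr K = -19683 := by
  haveI := T5CyclotomicNineSextic.numberField_nine K
  haveI : IsCyclotomicExtension {3 ^ (1 + 1)} ℚ K := ‹IsCyclotomicExtension {9} ℚ K›
  rw [IsCyclotomicExtension.Rat.discr_prime_pow_succ (p := 3) (k := 1) (K := K)]
  norm_num

/-- **`p ∤ disc ℚ(ζ₉)` for every prime `p ≠ 3`.** -/
theorem not_dvd_discr_nine (p : ℕ) [hp : Fact p.Prime] (hp3 : p ≠ 3) :
    haveI := T5CyclotomicNineSextic.numberField_nine K
    ¬ (p : ℤ) ∣ discr K := by
  haveI := T5CyclotomicNineSextic.numberField_nine K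
  rw [discr_nine K, dvd_neg]
  intro h
  have h3 : p ∣ 3 ^ 9 := by exact_mod_cast h
  exact hp3 ((Nat.prime_dvd_prime_iff_eq hp.out Nat.prime_three).mp (hp.out.dvd_of_dvd_pow h3))

variable {r : ℕ} (l : Fin r → 𝓞 K) (k : Type*) [Field k] [CharZero k]
variable (M : Matrix (Fin 3) (Fin 3) (𝓞 K)) (hM : IsUnit M.det)
  (hH : haveI := T5CyclotomicNineSextic.numberField_nine K; haveI := T5CyclotomicNineSextic.isCMField_nine K;
    ((algebraMap (𝓞 K) K).mapMatrix M).IsHermitian)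

include hM hH in
/-- **THE SECOND SEXTIC INSTANCE `ℚ(ζ₉)` AT EVERY PLACE ABOVE EVERY PRIME `p ≠ 3`.** -/
theorem record_hecke_nine_outside_three
    (hl : haveI := T5CyclotomicNineSextic.numberField_nine K;
      Submodule.span (𝓞 (maximalRealSubfield K)) (Set.range l) = ⊤)
    (p : ℕ) [Fact p.Prime] (hp3 : p ≠ 3)
    (v : haveI := T5CyclotomicNineSextic.numberField_nine K; HeightOneSpectrum (𝓞 (maximalRealSubfield K)))
    [hvp : v.asIdeal.LiesOver (span {(p : ℤ)})] :
    haveI := T5CyclotomicNineSextic.numberField_nine K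
    haveI := T5CyclotomicNineSextic.isCMField_nine K
    Conclusions K l k M p v :=
  haveI := T5CyclotomicNineSextic.numberField_nine K
  haveI := T5CyclotomicNineSextic.isCMField_nine K
  conclusions_of_not_dvd_discr K l k hl M hM hH p (not_dvd_discr_nine K p hp3) v

end Nine

end Summit.Ventures.HodgeRepro2.T5RecordSatakeCyclotomicDiscriminant
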